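import Literature.Analysis.PDE.SymmetricHyperbolicRegularised
import Mathlib.MeasureTheory.Measure.Haar.NormedSpace
import HarnessLib

/-!
# The mollifier family of scale `δ`: scaling of the kernel derivatives and the elementary
# commutator with a multiplication operator (topic `Analysis/PDE`)

Analytic layer of the energy-method existence theory for QUASILINEAR symmetric(rizable)
hyperbolic systems `∂ₜu + Σⱼ Ãⱼ(u)∂ⱼu + B̃(u) = 0` (Kato 1975; Majda 1984, Ch. 2; Taylor,
*PDE III*, Ch. 16 §§1–2), built for the symmetrizable branch of Rauch's Local Existence Theorem
(`Literature.Barriers.AtomisticToContinuum.Rauch1986_smallAmplitudeExpansionL2`). In Friedrichs'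
regularisation `∂ₜu = -J_δ[Σ Ãⱼ(v)∂ⱼJ_δu + B̃(v)]`, `v = ū + J_δu`, of a symmetriZABLE system the
energy is weighted by the symmetrizer `S̃(v)`, and closing the estimate uniformly in the scale
`δ` needs exactly two quantitative facts about the mollifier `J_δ` (`= ρ_δ ⋆ ·`) beyond those of
`MollifierL2.lean` / `MollifierRate.lean`:

* `moll ι hδ` — the kernel of scale `δ`: the normalisation of the bump `⟨δ/2, δ⟩` centred at
  `0`; `moll_apply_eq` — **scaling without a formula for the bump**: `ρ_δ(x) = δ⁻ⁿ ρ₁(x/δ)`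
  (Mathlib's bumps come from an unspecified `ContDiffBumpBase`, but `f x = base (r_out/r_in)
  (r_in⁻¹ x)` and the ratio `r_out/r_in = 2` is the same for every `δ`); hence
  `integral_abs_fderiv_moll` — `∫ |∂ⱼρ_δ| = δ⁻¹ ∫ |∂ⱼρ₁|`, and
  `l2norm_fderiv_convolution_moll_le` — **`‖∂ⱼ(ρ_δ ⋆ f)‖₂ ≤ (C₁/δ) ‖f‖₂`** for `f ∈ L²`
  (the derivative falls on the kernel, Young);
* `l2norm_commutator_moll_le` — **the elementary commutator**: for a `C¹` operator field `a` with
  `‖Da‖ ≤ L` and `g ∈ L²`, `‖ρ_δ ⋆ (a g) - a (ρ_δ ⋆ g)‖₂ ≤ δ L ‖g‖₂`: on the support of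
  `ρ_δ(x - y)` one has `‖a(y) - a(x)‖ ≤ L‖y - x‖ ≤ Lδ`, so the commutator is dominated pointwise by
  `Lδ (ρ_δ ⋆ ‖g‖)`, and Young's inequality with the unit-mass nonnegative kernel finishes. (This
  `O(δ)` bound for the commutator WITHOUT derivatives — not the Friedrichs lemma — is what the
  weighted energy identity consumes: it is paired with a factor carrying one extra derivative of
  `J_δ u`, of size `O(δ⁻¹)` by the first bullet.)

Everything is proved; no named fact and no `sorry` is introduced.

## References

* A. Majda, *Compressible Fluid Flow and Systems of Conservation Laws in Several Space
  Variables*, Springer 1984, Ch. 2, §2.1 (the mollified quasilinear scheme). [Majda1984]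
* M. E. Taylor, *Partial Differential Equations III*, 2nd ed., Springer 2011, Ch. 16, §1
  (1.9)–(1.15), §2. [TaylorPDEIII2011]
* L. C. Evans, *Partial Differential Equations*, 2nd ed., AMS 2010, App. C.4, Thm. 7. [Evans2010]
-/

noncomputable section

open MeasureTheory Set Function Filter Metric ContinuousLinearMap
open scoped ContDiff Topology RealInnerProductSpace ENNReal NNReal Convolution

namespace Literature.Analysis.PDE

open Literature.Analysis.FunctionSpaces

variable {ι : Type*} [Fintype ι]
variable {W : Type*} [NormedAddCommGroup W] [InnerProductSpace ℝ W] [CompleteSpace W]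

/-! ### Scaling of the kernel of scale `δ` -/

section Scale

omit [Fintype ι] in
/-- Inner radius `δ/2` of the tree's bump of scale `δ` (`bump ι hδ = ⟨δ/2, δ⟩`). [folklore] -/
@[simp] theorem bump_rIn_eq {δ : ℝ} (hδ : 0 < δ) : (bump ι hδ).rIn = δ / 2 := rfl

/-- **Scaling of the bumps**: `φ_δ(x) = φ₁(δ⁻¹ x)` (both are `base 2 (·)` at proportional
arguments). [folklore] -/
theorem bump_apply_eq (δ : ℝ) (hδ : 0 < δ) (x : EuclideanSpace ℝ ι) :
    bump ι hδ x = bump ι one_pos (δ⁻¹ • x) := by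
  rw [ContDiffBump.apply, ContDiffBump.apply]
  simp only [bump_rOut, bump_rIn_eq, sub_zero, smul_smul]
  have h1 : δ / (δ / 2) = (1 : ℝ) / (1 / 2) := by field_simp
  have h2 : (δ / 2)⁻¹ = (1 / 2 : ℝ)⁻¹ * δ⁻¹ := by field_simp
  rw [h1, h2]

/-- The dimension `n = |ι|` as the `finrank` of `ℝⁿ`. [folklore] -/
theorem finrank_eq_card : Module.finrank ℝ (EuclideanSpace ℝ ι) = Fintype.card ι :=
  finrank_euclideanSpace

/-- **Scaling of the masses**: `∫ φ_δ = δⁿ ∫ φ₁`. [folklore] -/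
theorem integral_bump (δ : ℝ) (hδ : 0 < δ) :
    ∫ x, bump ι hδ x = δ ^ Fintype.card ι * ∫ x, bump ι one_pos x := by
  have h := Measure.integral_comp_inv_smul_of_nonneg (volume : Measure (EuclideanSpace ℝ ι))
    (fun x => bump ι one_pos x) hδ.le
  rw [finrank_eq_card, smul_eq_mul] at h
  rw [← h]
  exact integral_congr_ae (Eventually.of_forall fun x => bump_apply_eq δ hδ x)

/-- **Scaling of the kernels**: `ρ_δ(x) = δ⁻ⁿ ρ₁(δ⁻¹ x)`. [folklore] -/
theorem moll_apply_eq (δ : ℝ) (hδ : 0 < δ) (x : EuclideanSpace ℝ ι) :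
    moll ι hδ x = (δ ^ Fintype.card ι)⁻¹ * moll ι one_pos (δ⁻¹ • x) := by
  rw [moll, moll, ContDiffBump.normed_def, ContDiffBump.normed_def, bump_apply_eq δ hδ x,
    integral_bump δ hδ]
  have hI : 0 < ∫ x, bump ι one_pos x := (bump ι one_pos).integral_pos
  have hδn : 0 < δ ^ Fintype.card ι := pow_pos hδ _
  field_simp

/-- The kernel is the composite of `ρ₁` with the dilation, times `δ⁻ⁿ`. [folklore] -/
theorem moll_eq_comp (δ : ℝ) (hδ : 0 < δ) :
    moll ι hδ = fun x => (δ ^ Fintype.card ι)⁻¹ * (moll ι one_pos ∘ fun y => δ⁻¹ • y) x :=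
  funext fun x => moll_apply_eq δ hδ x

/-- The kernel of scale `δ` vanishes for `‖x‖ ≥ δ`. [folklore] -/
theorem moll_eq_zero_of_le_norm (δ : ℝ) (hδ : 0 < δ) {x : EuclideanSpace ℝ ι} (hx : δ ≤ ‖x‖) :
    moll ι hδ x = 0 := by
  have hx' : x ∉ Function.support ((bump ι hδ).normed volume) := by
    rw [(bump ι hδ).support_normed_eq, bump_rOut, mem_ball_zero_iff, not_lt]
    exact hx
  simpa [moll] using hx'

/-- **Scaling of the kernel derivatives**: `∂ᵥρ_δ(x) = δ⁻ⁿ⁻¹ (∂ᵥρ₁)(δ⁻¹x)`. [folklore] -/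
theorem fderiv_moll_apply (δ : ℝ) (hδ : 0 < δ) (x v : EuclideanSpace ℝ ι) :
    fderiv ℝ (moll ι hδ) x v =
      (δ ^ Fintype.card ι)⁻¹ * (δ⁻¹ * fderiv ℝ (moll ι one_pos) (δ⁻¹ • x) v) := by
  have hdiff : Differentiable ℝ (moll ι one_pos) := (contDiff_moll one_pos).differentiable (by simp)
  have hlin : HasFDerivAt (fun y : EuclideanSpace ℝ ι => δ⁻¹ • y) (δ⁻¹ • ContinuousLinearMap.id ℝ _) x :=
    (ContinuousLinearMap.id ℝ _).hasFDerivAt.const_smul δ⁻¹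
  have hcomp : HasFDerivAt (moll ι one_pos ∘ fun y : EuclideanSpace ℝ ι => δ⁻¹ • y)
      ((fderiv ℝ (moll ι one_pos) (δ⁻¹ • x)).comp (δ⁻¹ • ContinuousLinearMap.id ℝ _)) x :=
    (hdiff (δ⁻¹ • x)).hasFDerivAt.comp x hlin
  have h := hcomp.const_mul ((δ ^ Fintype.card ι)⁻¹)
  rw [moll_eq_comp δ hδ, h.fderiv]
  simp

/-- **Scaling of the `L¹` norms of the kernel derivatives**: `∫ |∂ᵥρ_δ| = δ⁻¹ ∫ |∂ᵥρ₁|`.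
[folklore] -/
theorem integral_abs_fderiv_moll (δ : ℝ) (hδ : 0 < δ) (v : EuclideanSpace ℝ ι) :
    ∫ x, |fderiv ℝ (moll ι hδ) x v| = δ⁻¹ * ∫ x, |fderiv ℝ (moll ι one_pos) x v| := by
  have h := Measure.integral_comp_inv_smul_of_nonneg (volume : Measure (EuclideanSpace ℝ ι))
    (fun x => |fderiv ℝ (moll ι one_pos) x v|) hδ.le
  rw [finrank_eq_card, smul_eq_mul] at h
  have hδn : 0 < δ ^ Fintype.card ι := pow_pos hδ _
  calc ∫ x, |fderiv ℝ (moll ι hδ) x v|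
      = ∫ x, (δ ^ Fintype.card ι)⁻¹ * δ⁻¹ * |fderiv ℝ (moll ι one_pos) (δ⁻¹ • x) v| := by
        refine integral_congr_ae (Eventually.of_forall fun x => ?_)
        dsimp only
        rw [fderiv_moll_apply δ hδ x v, abs_mul, abs_mul, abs_of_pos (inv_pos.2 hδn),
          abs_of_pos (inv_pos.2 hδ), mul_assoc]
    _ = (δ ^ Fintype.card ι)⁻¹ * δ⁻¹ * (δ ^ Fintype.card ι * ∫ x, |fderiv ℝ (moll ι one_pos) x v|) := by
        rw [integral_const_mul, h]
    _ = δ⁻¹ * ∫ x, |fderiv ℝ (moll ι one_pos) x v| := by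
        field_simp

variable (ι) in
/-- The constant `C₁(v) = ∫ |∂ᵥρ₁|`. [folklore] -/
def mollDerivConst (v : EuclideanSpace ℝ ι) : ℝ := ∫ x, |fderiv ℝ (moll ι one_pos) x v|

/-- `0 ≤ C₁(v)`. [folklore] -/
theorem mollDerivConst_nonneg (v : EuclideanSpace ℝ ι) : 0 ≤ mollDerivConst ι v :=
  integral_nonneg fun _ => abs_nonneg _

end Scale

/-! ### One derivative of a mollified `L²` field costs `δ⁻¹` -/

section Deriv

omit [CompleteSpace W] in
/-- **`‖∂ᵥ(ρ_δ ⋆ f)‖₂ ≤ (C₁(v)/δ) ‖f‖₂`** for `f ∈ L²`: the derivative falls on the kernel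
(`fderiv_convolution_kernel_apply` along frame vectors, here for an arbitrary direction through
`HasCompactSupport.hasFDerivAt_convolution_left`) and Young's inequality applies with the kernel
`∂ᵥρ_δ` of mass `C₁(v)/δ`. [cite: Evans2010, App. C.4 Thm. 7] -/
theorem l2norm_fderiv_convolution_moll_le (δ : ℝ) (hδ : 0 < δ) {f : EuclideanSpace ℝ ι → W}
    (hf : MemLp f 2 (volume : Measure (EuclideanSpace ℝ ι))) (v : EuclideanSpace ℝ ι) :
    MemLp (fun x => fderiv ℝ (moll ι hδ ⋆[lsmul ℝ ℝ, volume] f) x v) 2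
        (volume : Measure (EuclideanSpace ℝ ι)) ∧
      l2norm (fun x => fderiv ℝ (moll ι hδ ⋆[lsmul ℝ ℝ, volume] f) x v) ≤
        mollDerivConst ι v / δ * l2norm f := by
  have hρ : ContDiff ℝ 1 (moll ι hδ) := (contDiff_moll hδ).of_le (by exact_mod_cast le_top)
  have hρc := hasCompactSupport_moll (ι := ι) hδ
  have hfl : LocallyIntegrable f (volume : Measure (EuclideanSpace ℝ ι)) := hf.locallyIntegrable one_le_two
  -- the derivative falls on the kernel
  have hD : ∀ x, fderiv ℝ (moll ι hδ ⋆[lsmul ℝ ℝ, volume] f) x v =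
      ((fun y => fderiv ℝ (moll ι hδ) y v) ⋆[lsmul ℝ ℝ, volume] f) x := by
    intro x
    have hDx := hρc.hasFDerivAt_convolution_left (lsmul ℝ ℝ : ℝ →L[ℝ] W →L[ℝ] W) hρ hfl x
    rw [hDx.fderiv]
    have hint : ConvolutionExistsAt (fderiv ℝ (moll ι hδ)) f x
        ((lsmul ℝ ℝ : ℝ →L[ℝ] W →L[ℝ] W).precompL (EuclideanSpace ℝ ι)) volume :=
      (hρc.fderiv ℝ).convolutionExists_left _ (hρ.continuous_fderiv one_ne_zero) hfl x
    rw [convolution_def, ContinuousLinearMap.integral_apply hint.integrable v, convolution_def]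
    simp only [precompL_apply, lsmul_apply]
  have hfun : (fun x => fderiv ℝ (moll ι hδ ⋆[lsmul ℝ ℝ, volume] f) x v) =
      (fun y => fderiv ℝ (moll ι hδ) y v) ⋆[lsmul ℝ ℝ, volume] f := funext hD
  rw [hfun]
  -- Young with the kernel `∂ᵥρ_δ`
  have hk : Continuous fun y => fderiv ℝ (moll ι hδ) y v :=
    (hρ.continuous_fderiv one_ne_zero).clm_apply continuous_const
  have hkc : HasCompactSupport fun y => fderiv ℝ (moll ι hδ) y v :=
    (hρc.fderiv ℝ).comp_left (g := fun L : EuclideanSpace ℝ ι →L[ℝ] ℝ => L v) rfl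
  obtain ⟨hmem, hle⟩ := memLp_convolution_kernel hk hkc hf
  refine ⟨hmem, hle.trans_eq ?_⟩
  rw [integral_abs_fderiv_moll δ hδ v, mollDerivConst, div_eq_inv_mul]

end Deriv

/-! ### The elementary commutator `[J_δ, a]` -/

section Commutator

/-- **Lipschitz bound from a derivative bound** on the whole space. [folklore] -/
theorem norm_sub_le_of_fderiv_le {V : Type*} [NormedAddCommGroup V] [NormedSpace ℝ V]
    {a : EuclideanSpace ℝ ι → V} (ha : ContDiff ℝ 1 a) {L : ℝ} (hL : ∀ x, ‖fderiv ℝ a x‖ ≤ L)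
    (x y : EuclideanSpace ℝ ι) : ‖a y - a x‖ ≤ L * ‖y - x‖ :=
  (convex_univ).norm_image_sub_le_of_norm_fderiv_le (fun z _ => (ha.differentiable one_ne_zero) z)
    (fun z _ => hL z) (mem_univ x) (mem_univ y)

/-- **Pointwise bound for the commutator**: for a `C¹` operator field `a` with `‖a‖ ≤ M`,
`‖Da‖ ≤ L`, a continuous `g ∈ L²` and every `x`,
`‖(ρ_δ ⋆ (a g))(x) - a(x)(ρ_δ ⋆ g)(x)‖ ≤ δL (ρ_δ ⋆ ‖g‖)(x)` — the commutator is
`∫ ρ_δ(t) (a(x-t) - a(x)) g(x-t) dt` and `‖t‖ < δ` on the support of `ρ_δ`.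
[cite: TaylorPDEIII2011, Ch. 16 §1] -/
theorem norm_commutator_moll_apply_le (δ : ℝ) (hδ : 0 < δ) {a : EuclideanSpace ℝ ι → (W →L[ℝ] W)}
    (ha : ContDiff ℝ 1 a) {M L : ℝ} (hM : ∀ x, ‖a x‖ ≤ M) (hL : ∀ x, ‖fderiv ℝ a x‖ ≤ L)
    {g : EuclideanSpace ℝ ι → W} (hgc : Continuous g)
    (hg : MemLp g 2 (volume : Measure (EuclideanSpace ℝ ι))) (x : EuclideanSpace ℝ ι) :
    ‖(moll ι hδ ⋆[lsmul ℝ ℝ, volume] fun y => a y (g y)) x -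
        a x ((moll ι hδ ⋆[lsmul ℝ ℝ, volume] g) x)‖ ≤
      (δ * L) * ‖(moll ι hδ ⋆[lsmul ℝ ℝ, volume] fun y => ‖g y‖) x‖ := by
  set ρ := moll ι hδ with hρdef
  have hρ : Continuous ρ := (contDiff_moll hδ).continuous
  have hρc : HasCompactSupport ρ := hasCompactSupport_moll hδ
  have hM0 : 0 ≤ M := (norm_nonneg (a 0)).trans (hM 0)
  have hL0 : 0 ≤ L := (norm_nonneg (fderiv ℝ a 0)).trans (hL 0)
  have hag : MemLp (fun y => a y (g y)) 2 (volume : Measure (EuclideanSpace ℝ ι)) :=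
    (memLp_clm_apply_and_l2norm_le ha.continuous hgc hg hM0 hM).1
  have hng : MemLp (fun y => ‖g y‖) 2 (volume : Measure (EuclideanSpace ℝ ι)) := hg.norm
  have hgl : LocallyIntegrable g (volume : Measure (EuclideanSpace ℝ ι)) := hg.locallyIntegrable one_le_two
  have hagl : LocallyIntegrable (fun y => a y (g y)) (volume : Measure (EuclideanSpace ℝ ι)) :=
    hag.locallyIntegrable one_le_two
  have hngl : LocallyIntegrable (fun y => ‖g y‖) (volume : Measure (EuclideanSpace ℝ ι)) :=
    hng.locallyIntegrable one_le_two
  have hexg : ConvolutionExistsAt ρ g x (lsmul ℝ ℝ) volume := hρc.convolutionExists_left _ hρ hgl x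
  have hexag : ConvolutionExistsAt ρ (fun y => a y (g y)) x (lsmul ℝ ℝ) volume :=
    hρc.convolutionExists_left _ hρ hagl x
  -- `a(x) ∫ ρ(t) g(x-t) = ∫ ρ(t) a(x) g(x-t)`
  have h1 : a x ((ρ ⋆[lsmul ℝ ℝ, volume] g) x) = ∫ t, ρ t • a x (g (x - t)) := by
    rw [convolution_def, ← (a x).integral_comp_comm hexg.integrable]
    refine integral_congr_ae (Eventually.of_forall fun t => ?_)
    simp only [lsmul_apply, map_smul]
  have h2 : (ρ ⋆[lsmul ℝ ℝ, volume] fun y => a y (g y)) x = ∫ t, ρ t • a (x - t) (g (x - t)) := by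
    rw [convolution_def]
    simp only [lsmul_apply]
  have hi1 : Integrable (fun t => ρ t • a (x - t) (g (x - t))) := hexag.integrable
  have hi2 : Integrable (fun t => ρ t • a x (g (x - t))) := by
    refine ((a x).integrable_comp hexg.integrable).congr (Eventually.of_forall fun t => ?_)
    simp only [lsmul_apply, map_smul]
  rw [h1, h2, ← integral_sub hi1 hi2]
  -- pointwise bound of the integrand
  have hbd : ∀ t, ‖ρ t • a (x - t) (g (x - t)) - ρ t • a x (g (x - t))‖ ≤
      (δ * L) * (ρ t * ‖g (x - t)‖) := by
    intro t
    have hrw : ρ t • a (x - t) (g (x - t)) - ρ t • a x (g (x - t)) =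
        ρ t • ((a (x - t) - a x) (g (x - t))) := by
      simp [smul_sub]
    rw [hrw, norm_smul, Real.norm_eq_abs, abs_of_nonneg (moll_nonneg hδ t)]
    by_cases ht : δ ≤ ‖t‖
    · have h0 : ρ t = 0 := moll_eq_zero_of_le_norm δ hδ ht
      have h0' : moll ι hδ t = 0 := moll_eq_zero_of_le_norm δ hδ ht
      simp [h0, h0']
    · have hat : ‖a (x - t) - a x‖ ≤ L * δ := by
        refine (norm_sub_le_of_fderiv_le ha hL x (x - t)).trans ?_
        rw [sub_sub_cancel_left, norm_neg]
        exact mul_le_mul_of_nonneg_left (not_le.1 ht).le hL0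
      calc ρ t * ‖(a (x - t) - a x) (g (x - t))‖
          ≤ ρ t * (‖a (x - t) - a x‖ * ‖g (x - t)‖) :=
            mul_le_mul_of_nonneg_left ((a (x - t) - a x).le_opNorm _) (moll_nonneg hδ t)
        _ ≤ ρ t * (L * δ * ‖g (x - t)‖) :=
            mul_le_mul_of_nonneg_left (mul_le_mul_of_nonneg_right hat (norm_nonneg _))
              (moll_nonneg hδ t)
        _ = δ * L * (ρ t * ‖g (x - t)‖) := by ring
  have hconv : (ρ ⋆[lsmul ℝ ℝ, volume] fun y => ‖g y‖) x = ∫ t, ρ t * ‖g (x - t)‖ := by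
    rw [convolution_def]
    simp only [lsmul_apply, smul_eq_mul]
  have hci : Integrable fun t => ρ t * ‖g (x - t)‖ :=
    ((hρc.convolutionExists_left (lsmul ℝ ℝ) hρ hngl x).integrable).congr
      (Eventually.of_forall fun t => by simp only [lsmul_apply, smul_eq_mul])
  calc ‖∫ t, (ρ t • a (x - t) (g (x - t)) - ρ t • a x (g (x - t)))‖
      ≤ ∫ t, ‖ρ t • a (x - t) (g (x - t)) - ρ t • a x (g (x - t))‖ := norm_integral_le_integral_norm _
    _ ≤ ∫ t, (δ * L) * (ρ t * ‖g (x - t)‖) :=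
        integral_mono_of_nonneg (Eventually.of_forall fun t => norm_nonneg _) (hci.const_mul _)
          (Eventually.of_forall hbd)
    _ = (δ * L) * ‖(ρ ⋆[lsmul ℝ ℝ, volume] fun y => ‖g y‖) x‖ := by
        rw [integral_const_mul, hconv, Real.norm_of_nonneg]
        exact integral_nonneg fun t => mul_nonneg (moll_nonneg hδ t) (norm_nonneg _)

/-- **The elementary commutator estimate.** For a `C¹` operator field `a : ℝⁿ → (W →L W)` with
`‖a‖ ≤ M`, `‖Da‖ ≤ L`, and a continuous `g ∈ L²`: the commutator
`x ↦ (ρ_δ ⋆ (a g))(x) - a(x) (ρ_δ ⋆ g)(x)` is in `L²` with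
`‖ρ_δ ⋆ (a g) - a (ρ_δ ⋆ g)‖₂ ≤ δ L ‖g‖₂` (the pointwise bound `norm_commutator_moll_apply_le` and
Young's inequality with the unit-mass kernel, `‖ρ_δ ⋆ ‖g‖‖₂ ≤ ‖g‖₂`).
[cite: TaylorPDEIII2011, Ch. 16 §1] -/
theorem l2norm_commutator_moll_le (δ : ℝ) (hδ : 0 < δ) {a : EuclideanSpace ℝ ι → (W →L[ℝ] W)}
    (ha : ContDiff ℝ 1 a) {M L : ℝ} (hM : ∀ x, ‖a x‖ ≤ M) (hL : ∀ x, ‖fderiv ℝ a x‖ ≤ L)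
    {g : EuclideanSpace ℝ ι → W} (hgc : Continuous g)
    (hg : MemLp g 2 (volume : Measure (EuclideanSpace ℝ ι))) :
    MemLp (fun x => (moll ι hδ ⋆[lsmul ℝ ℝ, volume] fun y => a y (g y)) x -
        a x ((moll ι hδ ⋆[lsmul ℝ ℝ, volume] g) x)) 2 (volume : Measure (EuclideanSpace ℝ ι)) ∧
      l2norm (fun x => (moll ι hδ ⋆[lsmul ℝ ℝ, volume] fun y => a y (g y)) x -
        a x ((moll ι hδ ⋆[lsmul ℝ ℝ, volume] g) x)) ≤ δ * L * l2norm g := by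
  set ρ := moll ι hδ with hρdef
  have hρ : Continuous ρ := (contDiff_moll hδ).continuous
  have hρc : HasCompactSupport ρ := hasCompactSupport_moll hδ
  have hM0 : 0 ≤ M := (norm_nonneg (a 0)).trans (hM 0)
  have hL0 : 0 ≤ L := (norm_nonneg (fderiv ℝ a 0)).trans (hL 0)
  have hag : MemLp (fun y => a y (g y)) 2 (volume : Measure (EuclideanSpace ℝ ι)) :=
    (memLp_clm_apply_and_l2norm_le ha.continuous hgc hg hM0 hM).1
  have hng : MemLp (fun y => ‖g y‖) 2 (volume : Measure (EuclideanSpace ℝ ι)) := hg.norm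
  have hgl : LocallyIntegrable g (volume : Measure (EuclideanSpace ℝ ι)) := hg.locallyIntegrable one_le_two
  have hagl : LocallyIntegrable (fun y => a y (g y)) (volume : Measure (EuclideanSpace ℝ ι)) :=
    hag.locallyIntegrable one_le_two
  -- continuity of the commutator (for measurability)
  have hcont : Continuous fun x => (ρ ⋆[lsmul ℝ ℝ, volume] fun y => a y (g y)) x -
      a x ((ρ ⋆[lsmul ℝ ℝ, volume] g) x) :=
    (hρc.continuous_convolution_left _ hρ hagl).sub
      (ha.continuous.clm_apply (hρc.continuous_convolution_left _ hρ hgl))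
  -- Young for the dominating function
  obtain ⟨hYmem, hYle⟩ := memLp_convolution_kernel hρ hρc hng
  have hmass : ∫ y, |ρ y| = 1 := by
    rw [show (fun y => |ρ y|) = ρ from funext fun y => abs_of_nonneg (moll_nonneg hδ y)]
    exact integral_moll hδ
  rw [hmass, one_mul] at hYle
  obtain ⟨hmem, hle⟩ := memLp_and_l2norm_le_of_le hcont hYmem (by positivity)
    (norm_commutator_moll_apply_le δ hδ ha hM hL hgc hg)
  refine ⟨hmem, hle.trans ?_⟩
  have hnorm : l2norm (fun y => ‖g y‖) = l2norm g := by
    simp only [l2norm_def, eLpNorm_norm]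
  calc δ * L * l2norm (ρ ⋆[lsmul ℝ ℝ, volume] fun y => ‖g y‖) ≤ δ * L * l2norm (fun y => ‖g y‖) :=
        mul_le_mul_of_nonneg_left hYle (by positivity)
    _ = δ * L * l2norm g := by rw [hnorm]

end Commutator

end Literature.Analysis.PDE

end
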